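import Mathlib
import HarnessLib

/-!
# Square-difference-free sets: Ruzsa's `65`-adic construction

Topic `Literature/Combinatorics/Additive`.  A set `K ⊆ ℕ` is *square-difference-free* if no two
of its elements differ by a non-zero perfect square; the Furstenberg–Sárközy theorem says such
sets have density `0` in `[0,N)`.  I. Z. Ruzsa, *Difference sets without squares*, Period. Math.
Hungar. 15 (1984) 205–209, Theorem 1, constructs square-difference-free subsets of `[0,N)` of
size `≫ N^{γ}` with `γ = (1 + log 7 / log 65)/2 = 0.7331…`: write numbers in base `65`, let the
digits at even positions range over a `7`-element set `R ⊆ ℤ/65` all of whose non-zero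
differences are quadratic non-residues modulo `5` or modulo `13`, and let the digits at odd
positions be arbitrary.  (Beigel–Gasarch and Lewko 2015 push `γ` to `0.7334` with base `205`.)

This file proves the construction in full, phrased without any new definition (the property is
spelled out as `∀ k k' ∈ K, ∀ j, k = k' + j² → j = 0`):

* `sqDiffFree_ruzsa_step` — one double-digit step `K ↦ {r + 65·d + 65²·k}`;
* `exists_sqDiffFree_ruzsa` — for every `t`, a square-difference-free `K ⊆ [0, 65^{2t})` with
  `|K| = 455^t`, using `R = {0, 2, 5, 22, 24, 43, 46}` (found and checked by exhaustive search;
  `7` is the maximum for base `65`);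
* `ruzsa_base65_numeric` — `4225^73 ≤ 455^100`, i.e. `γ ≥ 0.73`;
* `exists_sqDiffFree_card_ge` — for every `N ≥ 1`, a square-difference-free `K ⊆ [0,N)` with
  `455·|K| ≥ N^{73/100}`.

Used by `Summits/MatrixMultiplication/…/LevelGradedCohnUmansLevelOneGL2DesignsParabolaLift.lean`
(Hunter–Pohoata–Verstraëte–Zhang 2026, Theorem 1.2: point–line induced matchings of size
`p^{1.233}` over prime fields).  Not here: the Furstenberg–Sárközy upper bound.

## References

* I. Z. Ruzsa, *Difference sets without squares*, Period. Math. Hungar. 15 (1984) 205–209,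
  Theorem 1 and §2. [Ruzsa1984DifferenceSetsWithoutSquares]
* Z. Hunter, C. Pohoata, J. Verstraëte, S. Zhang, *Large point-line matchings and small Nikodym
  sets*, arXiv:2601.19879 (2026), Lemma 2.2. [HunterPohoataVerstraeteZhang2026]
-/

namespace Literature.Combinatorics.Additive

/-- **One `65`-adic digit step** (Ruzsa 1984).  Let `R ⊆ [0,65)` be such that the difference of
any two distinct elements is a quadratic non-residue mod `5` or mod `13`, and let `K ⊆ [0,B)`
have no non-zero square differences.  Then `{r + 65·d + 65²·k : r ∈ R, d < 65, k ∈ K} ⊆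
[0, 65²·B)` has `|R|·65·|K|` elements and no non-zero square differences: a difference with
`r ≠ r'` is `≡ r - r'` mod `5` and mod `13`; one with `r = r'`, `d ≠ d'` is `65·u` with
`65 ∤ u`, so `5` or `13` divides it exactly once; one with `r = r'`, `d = d'` is `65²·(k-k')`.
[cite: Ruzsa1984DifferenceSetsWithoutSquares, §2] -/
theorem sqDiffFree_ruzsa_step (R : Finset ℕ) (hR65 : ∀ r ∈ R, r < 65)
    (hR : ∀ r ∈ R, ∀ r' ∈ R, r ≠ r' →
      (∀ x : ZMod 5, x ^ 2 ≠ (r : ZMod 5) - r') ∨ (∀ x : ZMod 13, x ^ 2 ≠ (r : ZMod 13) - r'))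
    (B : ℕ) (K : Finset ℕ) (hKB : ∀ k ∈ K, k < B)
    (hK : ∀ k ∈ K, ∀ k' ∈ K, ∀ j : ℕ, k = k' + j ^ 2 → j = 0) :
    ∃ K' : Finset ℕ, K'.card = R.card * 65 * K.card ∧ (∀ k ∈ K', k < 4225 * B) ∧
      ∀ k ∈ K', ∀ k' ∈ K', ∀ j : ℕ, k = k' + j ^ 2 → j = 0 := by
  classical
  refine ⟨(R ×ˢ (Finset.range 65 ×ˢ K)).image fun x => x.1 + 65 * x.2.1 + 4225 * x.2.2,
    ?_, ?_, ?_⟩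
  · rw [Finset.card_image_of_injOn, Finset.card_product, Finset.card_product, Finset.card_range,
      mul_assoc]
    rintro ⟨r, d, k⟩ h ⟨r', d', k'⟩ h' heq
    simp only [Finset.coe_product, Finset.coe_range, Set.mem_prod, Finset.mem_coe, Set.mem_Iio]
      at h h'
    have hr := hR65 r h.1
    have hr' := hR65 r' h'.1
    simp only at heq
    simp only [Prod.mk.injEq]
    omega
  · rintro n hn
    simp only [Finset.mem_image, Finset.mem_product, Finset.mem_range, Prod.exists] at hn
    obtain ⟨r, d, k, ⟨hr, hd, hk⟩, rfl⟩ := hn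
    have := hR65 r hr
    have := hKB k hk
    nlinarith
  · intro n hn n' hn' j hj
    simp only [Finset.mem_image, Finset.mem_product, Finset.mem_range, Prod.exists] at hn hn'
    obtain ⟨r, d, k, ⟨hr, hd, hk⟩, rfl⟩ := hn
    obtain ⟨r', d', k', ⟨hr', hd', hk'⟩, rfl⟩ := hn'
    by_cases hrr : r = r'
    · subst hrr
      obtain ⟨J, hJ⟩ : ∃ J, J = j ^ 2 := ⟨_, rfl⟩
      rw [← hJ] at hj
      have h65 : 65 ∣ J := by omega
      have h5 : 5 ∣ j := Nat.prime_five.dvd_of_dvd_pow (n := 2)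
        (by rw [← hJ]; exact dvd_trans (by norm_num) h65)
      have h13 : 13 ∣ j := (by norm_num : Nat.Prime 13).dvd_of_dvd_pow (n := 2)
        (by rw [← hJ]; exact dvd_trans (by norm_num) h65)
      have h65j : 65 ∣ j := Nat.Coprime.mul_dvd_of_dvd_of_dvd (by norm_num) h5 h13
      obtain ⟨i, rfl⟩ := h65j
      have hJ' : J = 4225 * i ^ 2 := by rw [hJ]; ring
      by_cases hdd : d = d'
      · subst hdd
        have hkk : k = k' + i ^ 2 := by omega
        have := hK k hk k' hk' i hkk
        subst this
        rfl
      · exfalso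
        omega
    · exfalso
      rcases hR r hr r' hr' hrr with h5 | h13
      · have e := congrArg (Nat.cast : ℕ → ZMod 5) hj
        push_cast at e
        rw [show (65 : ZMod 5) = 0 by decide, show (4225 : ZMod 5) = 0 by decide] at e
        simp only [zero_mul, add_zero] at e
        exact h5 (j : ZMod 5) (by rw [e]; ring)
      · have e := congrArg (Nat.cast : ℕ → ZMod 13) hj
        push_cast at e
        rw [show (65 : ZMod 13) = 0 by decide, show (4225 : ZMod 13) = 0 by decide] at e
        simp only [zero_mul, add_zero] at e
        exact h13 (j : ZMod 13) (by rw [e]; ring)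

/-- **Ruzsa's square-difference-free sets** (base `65`, residue set `{0,2,5,22,24,43,46}`):
for every `t` there is `K ⊆ [0, 65^{2t})` with `|K| = 455^t = (65^{2t})^{0.7331…}` and no two
elements differing by a non-zero perfect square.
[cite: Ruzsa1984DifferenceSetsWithoutSquares, Theorem 1] -/
theorem exists_sqDiffFree_ruzsa (t : ℕ) :
    ∃ K : Finset ℕ, K.card = 455 ^ t ∧ (∀ k ∈ K, k < 4225 ^ t) ∧
      ∀ k ∈ K, ∀ k' ∈ K, ∀ j : ℕ, k = k' + j ^ 2 → j = 0 := by
  classical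
  induction t with
  | zero =>
    refine ⟨{0}, by simp, by simp, ?_⟩
    simp only [Finset.mem_singleton, forall_eq]
    intro j hj
    have : j ^ 2 = 0 := by omega
    exact pow_eq_zero_iff two_ne_zero |>.mp this
  | succ t ih =>
    obtain ⟨K, hcard, hlt, hK⟩ := ih
    obtain ⟨K', hcard', hlt', hK'⟩ :=
      sqDiffFree_ruzsa_step ({0, 2, 5, 22, 24, 43, 46} : Finset ℕ) (by decide) (by decide) (4225 ^ t)
        K hlt hK
    refine ⟨K', ?_, ?_, hK'⟩
    · rw [hcard', hcard, show ({0, 2, 5, 22, 24, 43, 46} : Finset ℕ).card = 7 by rfl]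
      ring
    · intro k hk
      have := hlt' k hk
      rw [pow_succ]
      linarith

/-- The numerical inequality `4225^73 ≤ 455^100`, i.e. `log 455 / log 4225 ≥ 0.73`: the exponent
of Ruzsa's base-`65` construction is at least `0.73`. [folklore] -/
theorem ruzsa_base65_numeric : (4225 : ℕ) ^ 73 ≤ 455 ^ 100 := by norm_num

/-- **Ruzsa's theorem, `N`-form.**  For every `N ≥ 1` there is a square-difference-free
`K ⊆ [0,N)` with `455·|K| ≥ N^{73/100}`: take `65^{2t} ≤ N < 65^{2t+2}` in
`exists_sqDiffFree_ruzsa`. [cite: Ruzsa1984DifferenceSetsWithoutSquares, Theorem 1] -/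
theorem exists_sqDiffFree_card_ge (N : ℕ) (hN : N ≠ 0) :
    ∃ K : Finset ℕ, (∀ k ∈ K, k < N) ∧ (∀ k ∈ K, ∀ k' ∈ K, ∀ j : ℕ, k = k' + j ^ 2 → j = 0) ∧
      (N : ℝ) ^ (73 / 100 : ℝ) ≤ 455 * (K.card : ℝ) := by
  classical
  set t := Nat.log 4225 N with ht
  obtain ⟨K, hcard, hlt, hK⟩ := exists_sqDiffFree_ruzsa t
  have h4225 : 4225 ^ t ≤ N := Nat.pow_log_le_self 4225 hN
  refine ⟨K, fun k hk => lt_of_lt_of_le (hlt k hk) h4225, hK, ?_⟩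
  rw [hcard]
  push_cast
  have hltN : N < 4225 ^ (t + 1) := Nat.lt_pow_succ_log_self (by norm_num) N
  have key : N ^ 73 ≤ (455 ^ (t + 1)) ^ 100 := by
    calc N ^ 73 ≤ (4225 ^ (t + 1)) ^ 73 := Nat.pow_le_pow_left hltN.le 73
      _ = (4225 ^ 73) ^ (t + 1) := by rw [← pow_mul, ← pow_mul, mul_comm]
      _ ≤ (455 ^ 100) ^ (t + 1) := Nat.pow_le_pow_left ruzsa_base65_numeric _
      _ = (455 ^ (t + 1)) ^ 100 := by rw [← pow_mul, ← pow_mul, mul_comm]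
  have keyR : ((N : ℝ)) ^ (73 : ℕ) ≤ ((455 : ℝ) ^ (t + 1)) ^ (100 : ℕ) := by
    exact_mod_cast key
  have e1 : (N : ℝ) ^ (73 / 100 : ℝ) = (((N : ℝ)) ^ (73 : ℕ)) ^ ((100 : ℕ) : ℝ)⁻¹ := by
    rw [← Real.rpow_natCast, ← Real.rpow_mul (by positivity)]
    norm_num
  rw [e1]
  calc (((N : ℝ)) ^ (73 : ℕ)) ^ ((100 : ℕ) : ℝ)⁻¹
      ≤ (((455 : ℝ) ^ (t + 1)) ^ (100 : ℕ)) ^ ((100 : ℕ) : ℝ)⁻¹ :=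
        Real.rpow_le_rpow (by positivity) keyR (by positivity)
    _ = (455 : ℝ) ^ (t + 1) := Real.pow_rpow_inv_natCast (by positivity) (by norm_num)
    _ = 455 * 455 ^ t := by ring

end Literature.Combinatorics.Additive
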